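import Mathlib.Combinatorics.SimpleGraph.Connectivity.EdgeConnectivity
import Mathlib.Combinatorics.SimpleGraph.Paths
import HarnessLib

/-!
# Edges separating two vertices: sides, orientation, linear order, the first bridge

Pure graph theory behind the "first pivotal bond" decomposition of the lace expansion
(A. Sakai, *Lace expansion for the Ising model*, CMP 272 (2007), §2.2.1, (2.9): for a bond
configuration, `1{o ⟷ x} = 1{o ⟺ x} + Σ_b 1{o ⟺ b̲ off b} 1{n_b > 0} 1{b̄ ⟷ x in 𝒞^b(o)ᶜ}`, the sum
having exactly one nonzero term — the first pivotal bond — when `o` is connected but not doubly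
connected to `x`; the same decomposition is used for percolation, Hara–Slade 1990).

For a simple graph `T`, vertices `o, x`: an edge `e` SEPARATES `o` from `x` (`SepEdge`) if its
deletion disconnects them (Sakai's "pivotal bond"); its `o`-SIDE (`sepSide`) is the set of vertices
reachable from `o` avoiding `e` (Sakai's `𝒞^b(o)`). Proved: (1) the boundary lemma — the only
edge of `T` leaving the side is `e` — and the ORIENTATION of a separating edge (exactly one
endpoint, the near one, lies on the side); (2) along a path, every dart is left behind by a prefix
avoiding its own edge (`reachable_deleteEdges_fst_of_mem_darts`), whence separating edges are
traversed near-to-far and the suffix after one stays off its side (`SepEdge.exists_walk_off_side`);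
(3) the sides of two distinct separating edges are STRICTLY NESTED (`side_ssubset_or`), i.e. the
separating edges are linearly ordered; (4) for finitely many vertices there is a unique FIRST
separating edge (smallest side), characterised by: `o` is `2`-edge-connected to its near
endpoint once it is deleted (`IsFirstSepEdge.isEdgeReachable_two`, `isFirstSepEdge_of_isEdgeReachable_two`); (5) the first pivotal DART (`IsFirstDart`: the first separating edge oriented near-to-far with the
walk off its side) exists iff `o ⟷ x` without `2`-edge-reachability (Mathlib's
`T.IsEdgeReachable 2 o x`, Sakai's double connection) and is unique
(`exists_isFirstDart_iff`, `subsingleton_isFirstDart`).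

## References

* A. Sakai, Comm. Math. Phys. 272 (2007) 283–344, arXiv:math-ph/0510093, Definition 2.1 and
  (2.9) [Sakai2007].
-/

namespace Literature.Combinatorics.SimpleGraph

open _root_.SimpleGraph

variable {V : Type*} (T : _root_.SimpleGraph V)

/-! ## Separating edges and their sides -/

/-- `e` separates `o` from `x` in `T`: `e` is an edge and `o`, `x` are disconnected once it is
deleted (for `T`-connected `o, x`: a bridge lying on every `o`–`x` walk; Sakai's pivotal bond,
unoriented). [cite: Sakai2007, Definition 2.1 (iii)] -/
def SepEdge (o x : V) (e : Sym2 V) : Prop := e ∈ T.edgeSet ∧ ¬(T.deleteEdges {e}).Reachable o x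

/-- The `o`-side of `e`: the vertices reachable from `o` avoiding `e` (Sakai's `𝒞^b(o)`).
[cite: Sakai2007, Definition 2.1 (ii)] -/
def sepSide (o : V) (e : Sym2 V) : Set V := {y | (T.deleteEdges {e}).Reachable o y}

variable {T}

/-- `o` lies on its own side. [folklore] -/
theorem mem_side_self (o : V) (e : Sym2 V) : o ∈ sepSide T o e := Reachable.refl o

/-- A separating edge keeps `x` off the `o`-side. [folklore] -/
theorem SepEdge.not_mem_side {o x : V} {e : Sym2 V} (h : SepEdge T o x e) : x ∉ sepSide T o e := h.2

/-- The side is closed under adjacency along edges other than `e`. [folklore] -/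
theorem mem_side_of_adj {o y z : V} {e : Sym2 V} (hy : y ∈ sepSide T o e) (hadj : T.Adj y z)
    (hne : s(y, z) ≠ e) : z ∈ sepSide T o e :=
  hy.trans (Adj.reachable ((deleteEdges_adj).2 ⟨hadj, by simpa using hne⟩))

/-- **Boundary lemma**: the only edge of `T` leaving the `o`-side of `e` is `e` itself. [folklore] -/
theorem edge_eq_of_mem_side_of_not_mem {o y z : V} {e : Sym2 V} (hy : y ∈ sepSide T o e)
    (hz : z ∉ sepSide T o e) (hadj : T.Adj y z) : s(y, z) = e := by
  by_contra hne
  exact hz (mem_side_of_adj hy hadj hne)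

/-- **Orientation**: for `T`-connected `o, x`, a separating edge has an endpoint on the `o`-side
and an endpoint off it (the near and far endpoints `b̲`, `b̄`). [cite: Sakai2007, Definition 2.1 (iii)] -/
theorem SepEdge.exists_near_far {o x : V} {e : Sym2 V} (he : SepEdge T o x e) (hox : T.Reachable o x) :
    ∃ u w : V, e = s(u, w) ∧ T.Adj u w ∧ u ∈ sepSide T o e ∧ w ∉ sepSide T o e := by
  obtain ⟨p⟩ := hox
  obtain ⟨d, -, hd1, hd2⟩ := p.exists_boundary_dart (sepSide T o e) (mem_side_self o e) he.not_mem_side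
  exact ⟨d.fst, d.snd, (edge_eq_of_mem_side_of_not_mem hd1 hd2 d.adj).symm, d.adj, hd1, hd2⟩

/-- The endpoints of a separating edge lie on opposite sides: if one is on the `o`-side the other
is not. [folklore] -/
theorem SepEdge.not_mem_side_of_mem {o x u w : V} (he : SepEdge T o x s(u, w)) (hox : T.Reachable o x)
    (hu : u ∈ sepSide T o s(u, w)) : w ∉ sepSide T o s(u, w) := by
  obtain ⟨u', w', heq, -, hu', hw'⟩ := he.exists_near_far hox
  rcases Sym2.eq_iff.1 heq with ⟨rfl, rfl⟩ | ⟨rfl, rfl⟩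
  · exact hw'
  · exact absurd hu hw'

/-! ## Paths: prefixes avoid the edge of the next dart -/

/-- No dart of the prefix of a walk up to the first visit of `u` starts at `u`. [folklore] -/
theorem fst_ne_of_mem_darts_takeUntil [DecidableEq V] {v w u : V} {p : T.Walk v w}
    (hu : u ∈ p.support) {d : T.Dart} (hd : d ∈ (p.takeUntil u hu).darts) : d.fst ≠ u := by
  intro h
  have hcount := p.count_support_takeUntil_eq_one hu
  rw [← Walk.map_fst_darts_append, List.count_append] at hcount
  have h1 : 0 < (((p.takeUntil u hu).darts.map (·.fst)).count u) :=
    List.count_pos_iff.2 (List.mem_map.2 ⟨d, hd, h⟩)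
  simp only [List.count_singleton_self] at hcount
  omega

/-- **In a path, the prefix up to the start of a dart avoids the dart's edge.** [folklore] -/
theorem edge_not_mem_edges_takeUntil [DecidableEq V] {v w : V} {p : T.Walk v w} (hp : p.IsPath)
    {d : T.Dart} (hd : d ∈ p.darts) :
    d.edge ∉ (p.takeUntil d.fst (p.dart_fst_mem_support_of_mem_darts hd)).edges := by
  set h := p.dart_fst_mem_support_of_mem_darts hd
  have hspec := p.take_spec h
  have hnodup : p.edges.Nodup := Walk.edges_nodup_of_support_nodup hp.support_nodup
  have hd' : d ∈ (p.takeUntil _ h).darts ++ (p.dropUntil _ h).darts := by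
    rw [← Walk.darts_append, hspec]; exact hd
  rcases List.mem_append.1 hd' with h1 | h2
  · exact absurd rfl (fst_ne_of_mem_darts_takeUntil h h1)
  · intro hmem
    have hsplit : (p.takeUntil _ h).edges ++ (p.dropUntil _ h).edges = p.edges := by
      rw [← Walk.edges_append, hspec]
    rw [← hsplit] at hnodup
    exact List.disjoint_of_nodup_append hnodup hmem (List.mem_map_of_mem h2)

/-- In a path, the start of every dart is reachable from the origin avoiding the dart's edge.
[folklore] -/
theorem reachable_deleteEdges_fst_of_mem_darts {v w : V} {p : T.Walk v w} (hp : p.IsPath)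
    {d : T.Dart} (hd : d ∈ p.darts) : (T.deleteEdges {d.edge}).Reachable v d.fst := by
  classical
  rw [show d.edge = s(d.fst, d.snd) from rfl, reachable_deleteEdges_iff_exists_walk]
  exact ⟨p.takeUntil d.fst (p.dart_fst_mem_support_of_mem_darts hd), edge_not_mem_edges_takeUntil hp hd⟩

/-- In a path, the endpoint is reachable from the end of every dart avoiding the dart's edge.
[folklore] -/
theorem reachable_deleteEdges_snd_of_mem_darts {v w : V} {p : T.Walk v w} (hp : p.IsPath)
    {d : T.Dart} (hd : d ∈ p.darts) : (T.deleteEdges {d.edge}).Reachable d.snd w := by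
  have h := reachable_deleteEdges_fst_of_mem_darts (p := p.reverse) hp.reverse
    (d := d.symm) (Walk.mem_darts_reverse.2 (by simpa using hd))
  rw [Dart.edge_symm] at h
  exact h.symm

/-- Two darts of a path with the same edge coincide. [folklore] -/
theorem dart_eq_of_edge_eq {v w : V} {p : T.Walk v w} (hp : p.IsPath) {d d' : T.Dart}
    (hd : d ∈ p.darts) (hd' : d' ∈ p.darts) (h : d.edge = d'.edge) : d = d' :=
  List.inj_on_of_nodup_map (Walk.edges_nodup_of_support_nodup hp.support_nodup) hd hd' h

/-- Two darts of a path with the same start coincide. [folklore] -/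
theorem dart_eq_of_fst_eq {v w : V} {p : T.Walk v w} (hp : p.IsPath) {d d' : T.Dart}
    (hd : d ∈ p.darts) (hd' : d' ∈ p.darts) (h : d.fst = d'.fst) : d = d' := by
  have hnd : (p.darts.map (·.fst)).Nodup := by
    rw [Walk.map_fst_darts]
    exact hp.support_nodup.sublist (List.dropLast_sublist _)
  exact List.inj_on_of_nodup_map hnd hd hd' h

/-! ## Separating edges along a path -/

/-- A separating edge lies on every `o`–`x` walk. [cite: Sakai2007, Definition 2.1 (iii)] -/
theorem SepEdge.mem_edges {o x : V} {e : Sym2 V} (he : SepEdge T o x e) (p : T.Walk o x) :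
    e ∈ p.edges := by
  induction e using Sym2.ind with
  | _ a b =>
    by_contra h
    exact he.2 (reachable_deleteEdges_iff_exists_walk.2 ⟨p, h⟩)

/-- A separating edge is traversed by a dart of every `o`–`x` walk. [folklore] -/
theorem SepEdge.exists_dart {o x : V} {e : Sym2 V} (he : SepEdge T o x e) (p : T.Walk o x) :
    ∃ d ∈ p.darts, d.edge = e :=
  List.mem_map.1 (he.mem_edges p)

/-- **Near-to-far traversal**: along an `o`–`x` path a separating edge is entered from its
`o`-side and left off it. [cite: Sakai2007, Definition 2.1 (iii)] -/
theorem SepEdge.fst_mem_side {o x : V} {e : Sym2 V} (he : SepEdge T o x e) {p : T.Walk o x}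
    (hp : p.IsPath) {d : T.Dart} (hd : d ∈ p.darts) (hde : d.edge = e) :
    d.fst ∈ sepSide T o e ∧ d.snd ∉ sepSide T o e := by
  subst hde
  refine ⟨reachable_deleteEdges_fst_of_mem_darts hp hd, fun hsnd => ?_⟩
  exact he.2 (hsnd.trans (reachable_deleteEdges_snd_of_mem_darts hp hd))

/-- The near endpoint of a separating edge determines its dart on a path. [folklore] -/
theorem SepEdge.dart_eq {o x u w : V} (he : SepEdge T o x s(u, w)) {p : T.Walk o x} (hp : p.IsPath)
    {d : T.Dart} (hd : d ∈ p.darts) (hde : d.edge = s(u, w)) (hu : u ∈ sepSide T o s(u, w)) :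
    d.fst = u ∧ d.snd = w := by
  have h := he.fst_mem_side hp hd hde
  rw [show d.edge = s(d.fst, d.snd) from rfl, Sym2.eq_iff] at hde
  rcases hde with ⟨h1, h2⟩ | ⟨h1, h2⟩
  · exact ⟨h1, h2⟩
  · exact absurd (h2 ▸ hu) h.2

/-- **The suffix stays off the side**: past a separating edge, an `o`–`x` path — indeed any walk
avoiding the edge from a vertex to `x` — never returns to the `o`-side; in particular `x` is
joined to the far endpoint by a walk all of whose vertices lie off the side (Sakai's
`b̄ ⟷ x in 𝒞^b(o)ᶜ`). [cite: Sakai2007, (2.9)] -/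
theorem SepEdge.exists_walk_off_side {o x y : V} {e : Sym2 V} (he : SepEdge T o x e)
    (hy : (T.deleteEdges {e}).Reachable y x) :
    ∃ q : T.Walk y x, ∀ z ∈ q.support, z ∉ sepSide T o e := by
  classical
  obtain ⟨q⟩ := hy
  refine ⟨q.mapLe (deleteEdges_le {e}), fun z hz hzside => ?_⟩
  rw [Walk.support_mapLe_eq_support] at hz
  exact he.2 (hzside.trans ⟨q.dropUntil z hz⟩)


/-! ## The linear order of separating edges -/

/-- A vertex joined to `x` by a walk avoiding `e` is off the `o`-side of the separating edge `e`.
[folklore] -/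
theorem SepEdge.not_mem_side_of_walk {o x z : V} {e : Sym2 V} (he : SepEdge T o x e)
    (q : T.Walk z x) (hq : e ∉ q.edges) : z ∉ sepSide T o e := fun hz =>
  he.2 (hz.trans ⟨q.toDeleteEdge e hq⟩)

/-- **Outside forces nesting**: if an endpoint `u_f` of `f = s(u_f, w_f)` lies on the `o`-side of `f`
but off the `o`-side of `e`, then the `o`-side of `e` is strictly inside the `o`-side of `f` (a walk
avoiding `e` never visits `u_f`, so avoids `f`). [cite: Sakai2007, (2.9)] -/
theorem side_ssubset_of_not_mem {o uf wf : V} {e : Sym2 V}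
    (huf : uf ∈ sepSide T o s(uf, wf)) (hout : uf ∉ sepSide T o e) : sepSide T o e ⊂ sepSide T o s(uf, wf) := by
  classical
  refine (Set.ssubset_iff_of_subset fun y hy => ?_).2 ⟨uf, huf, hout⟩
  -- a walk `o → y` avoiding `e` avoids `f` as well (it never visits `u_f`)
  obtain ⟨q⟩ := hy
  have hq : s(uf, wf) ∉ q.edges := fun hmem =>
    hout ⟨q.takeUntil uf (q.fst_mem_support_of_mem_edges hmem)⟩
  have h : ((T.deleteEdges {e}).deleteEdges {s(uf, wf)}).Reachable o y := ⟨q.toDeleteEdge s(uf, wf) hq⟩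
  exact h.mono (deleteEdges_mono (deleteEdges_le {e}))

/-- **Inside forces precedence** (the splice argument): for distinct separating edges
`e = s(u_e, w_e)`, `f = s(u_f, w_f)` (near endpoints first), if `u_f` is on the `o`-side of `e`
then `u_e` is off the `o`-side of `f`. [cite: Sakai2007, (2.9)] -/
theorem near_not_mem_side {o x ue we uf wf : V} (he : SepEdge T o x s(ue, we))
    (hf : SepEdge T o x s(uf, wf)) (hox : T.Reachable o x) (hne : s(ue, we) ≠ s(uf, wf))
    (hue : ue ∈ sepSide T o s(ue, we)) (huf : uf ∈ sepSide T o s(uf, wf))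
    (hin : uf ∈ sepSide T o s(ue, we)) : ue ∉ sepSide T o s(uf, wf) := by
  classical
  obtain ⟨p, hp⟩ := hox.exists_isPath
  obtain ⟨de, hde, hdee⟩ := he.exists_dart p
  obtain ⟨df, hdf, hdff⟩ := hf.exists_dart p
  obtain ⟨hde1, hde2⟩ := he.dart_eq hp hde hdee hue
  obtain ⟨hdf1, hdf2⟩ := hf.dart_eq hp hdf hdff huf
  have hwf : wf ∉ sepSide T o s(uf, wf) := hf.not_mem_side_of_mem hox huf
  -- `f` lies on the prefix before `u_e` or on the suffix after it
  have hue_supp : ue ∈ p.support := hde1 ▸ p.dart_fst_mem_support_of_mem_darts hde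
  have hfmem : s(uf, wf) ∈ (p.takeUntil ue hue_supp).edges ++ (p.dropUntil ue hue_supp).edges := by
    rw [← Walk.edges_append, p.take_spec]; exact hf.mem_edges p
  rcases List.mem_append.1 hfmem with h1 | h2
  · -- `f` before `u_e`: the prefix, past `f`, joins `w_f` to `u_e` avoiding `f`
    intro hmem
    obtain ⟨d', hd', hd'f⟩ := List.mem_map.1 h1
    have hd'p : d' ∈ p.darts := p.darts_takeUntil_subset_darts hue_supp hd'
    have hdd : d' = df := dart_eq_of_edge_eq hp hd'p hdf (hd'f.trans hdff.symm)
    have hr := reachable_deleteEdges_snd_of_mem_darts (hp.takeUntil hue_supp) hd'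
    rw [hd'f, hdd, hdf2] at hr
    exact hwf (hmem.trans hr.symm)
  · -- `f` after `u_e`: then `u_f` comes after `w_e` and is off the side of `e`
    exfalso
    have hx : ue ≠ x := fun h => he.not_mem_side (h ▸ hue)
    obtain ⟨v1, hadj, s', hs⟩ := (p.dropUntil ue hue_supp).exists_eq_cons_of_ne hx
    have hspath : (p.dropUntil ue hue_supp).IsPath := hp.dropUntil hue_supp
    rw [hs] at h2 hspath
    rw [Walk.cons_isPath_iff] at hspath
    -- the first dart of the suffix is the dart of `e`
    have hd0 : (⟨(ue, v1), hadj⟩ : T.Dart) ∈ p.darts := by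
      refine p.darts_dropUntil_subset_darts hue_supp ?_
      rw [hs, Walk.darts_cons]
      exact List.mem_cons_self
    have hv1 : v1 = we := by
      have := dart_eq_of_fst_eq hp hd0 hde (hde1.symm ▸ rfl)
      rw [← hde2, ← this]
    subst hv1
    rw [Walk.edges_cons] at h2
    rcases List.mem_cons.1 h2 with h3 | h3
    · exact hne h3.symm
    · -- `u_f ∈ s'.support`, and `s'` avoids `e`
      have hes' : s(ue, v1) ∉ s'.edges := fun h4 => hspath.2 (s'.fst_mem_support_of_mem_edges h4)
      have hufs : uf ∈ s'.support := s'.fst_mem_support_of_mem_edges h3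
      have hq := he.not_mem_side_of_walk (s'.dropUntil uf hufs)
        (fun h5 => hes' (s'.edges_dropUntil_subset_edges hufs h5))
      exact hq hin

/-- **Separating edges are linearly ordered by their sides**: for distinct separating edges
`e = s(u_e, w_e)` and `f = s(u_f, w_f)` (near endpoints first) either the side of `e` is strictly
inside the side of `f` and `f` starts off the side of `e`, or conversely. [cite: Sakai2007, (2.9)] -/
theorem side_ssubset_or {o x ue we uf wf : V} (he : SepEdge T o x s(ue, we))
    (hf : SepEdge T o x s(uf, wf)) (hox : T.Reachable o x) (hne : s(ue, we) ≠ s(uf, wf))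
    (hue : ue ∈ sepSide T o s(ue, we)) (huf : uf ∈ sepSide T o s(uf, wf)) :
    (sepSide T o s(ue, we) ⊂ sepSide T o s(uf, wf) ∧ uf ∉ sepSide T o s(ue, we)) ∨
      (sepSide T o s(uf, wf) ⊂ sepSide T o s(ue, we) ∧ ue ∉ sepSide T o s(uf, wf)) := by
  by_cases hin : uf ∈ sepSide T o s(ue, we)
  · have hout := near_not_mem_side he hf hox hne hue huf hin
    exact Or.inr ⟨side_ssubset_of_not_mem hue hout, hout⟩
  · exact Or.inl ⟨side_ssubset_of_not_mem huf hin, hin⟩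


/-! ## The first separating edge -/

/-- In a path, no dart starts at the final vertex. [folklore] -/
theorem fst_ne_end_of_mem_darts {v w : V} {p : T.Walk v w} (hp : p.IsPath) {d : T.Dart}
    (hd : d ∈ p.darts) : d.fst ≠ w := by
  intro h
  have hnd := hp.support_nodup
  rw [← Walk.map_fst_darts_append, List.nodup_append] at hnd
  exact hnd.2.2 _ (List.mem_map.2 ⟨d, hd, h⟩) _ (List.mem_singleton_self w) rfl

variable (T) in
/-- `e` is the FIRST edge separating `o` from `x`: a separating edge whose `o`-side is strictly
inside the `o`-side of every other separating edge ("we take the first bond among them").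
[cite: Sakai2007, §2.2.1 (before (2.9))] -/
def IsFirstSepEdge (o x : V) (e : Sym2 V) : Prop :=
  SepEdge T o x e ∧ ∀ f, SepEdge T o x f → f ≠ e → sepSide T o e ⊂ sepSide T o f

/-- The first separating edge is unique. [folklore] -/
theorem IsFirstSepEdge.unique {o x : V} {e e' : Sym2 V} (h : IsFirstSepEdge T o x e) (h' : IsFirstSepEdge T o x e') :
    e = e' := by
  by_contra hne
  exact (h.2 e' h'.1 (Ne.symm hne)).2 (h'.2 e h.1 hne).1

/-- **Existence of the first separating edge** on a finite vertex set: a separating edge with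
inclusion-minimal side is first, by the linear order of sides. [cite: Sakai2007, §2.2.1 (before (2.9))] -/
theorem exists_isFirstSepEdge [Finite V] {o x : V} {e₀ : Sym2 V} (he₀ : SepEdge T o x e₀)
    (hox : T.Reachable o x) : ∃ e, IsFirstSepEdge T o x e := by
  obtain ⟨e, he, hmin⟩ := Set.Finite.exists_minimalFor (sepSide T o) {e | SepEdge T o x e}
    (Set.toFinite _) ⟨e₀, he₀⟩
  refine ⟨e, he, fun f hf hfe => ?_⟩
  obtain ⟨ue, we, rfl, -, hue, -⟩ := SepEdge.exists_near_far he hox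
  obtain ⟨uf, wf, rfl, -, huf, -⟩ := SepEdge.exists_near_far hf hox
  rcases side_ssubset_or he hf hox (Ne.symm hfe) hue huf with ⟨h, -⟩ | ⟨h, -⟩
  · exact h
  · exact absurd (hmin hf h.1) (not_subset_of_ssubset h)

/-- **The first edge through 2-edge-connectivity, forward**: once the first separating edge
`s(u, w)` (near endpoint `u`) is deleted, `o` is `2`-edge-connected to `u` — no bridge precedes the
first one. [cite: Sakai2007, (2.9) (the factor 1{o ⟺ b̲ off b})] -/
theorem IsFirstSepEdge.isEdgeReachable_two {o x u w : V} (h : IsFirstSepEdge T o x s(u, w))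
    (hox : T.Reachable o x) (hu : u ∈ sepSide T o s(u, w)) :
    (T.deleteEdges {s(u, w)}).IsEdgeReachable 2 o u := by
  classical
  have he := h.1
  have hw : w ∉ sepSide T o s(u, w) := he.not_mem_side_of_mem hox hu
  rw [_root_.SimpleGraph.isEdgeReachable_two]
  intro g
  induction g using Sym2.ind with
  | _ a b =>
  by_contra hng
  -- `g` is an edge of `T ∖ e`
  have hg : s(a, b) ∈ (T.deleteEdges {s(u, w)}).edgeSet := by
    by_contra hg
    apply hng
    rw [deleteEdges_eq_self.2 (Set.disjoint_singleton_right.2 hg)]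
    exact hu
  rw [edgeSet_deleteEdges] at hg
  have hge : s(a, b) ≠ s(u, w) := by simpa using hg.2
  -- `g` separates `o` from `x` in `T`: an `o`–`x` path avoiding `g` would reach `u` avoiding `e` too
  have hsep : SepEdge T o x s(a, b) := by
    refine ⟨hg.1, fun hr => hng ?_⟩
    obtain ⟨r₀, hr₀⟩ := reachable_deleteEdges_iff_exists_walk.1 hr
    set r := r₀.bypass with hr_def
    have hrp : r.IsPath := r₀.bypass_isPath
    have hgr : s(a, b) ∉ r.edges := fun h' => hr₀ (r₀.edges_bypass_subset_edges h')
    obtain ⟨d, hd, hde⟩ := he.exists_dart r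
    obtain ⟨hd1, hd2⟩ := he.dart_eq hrp hd hde hu
    have hpre := edge_not_mem_edges_takeUntil hrp hd
    rw [hde] at hpre
    set pre := r.takeUntil d.fst (r.dart_fst_mem_support_of_mem_darts hd)
    have hgpre : s(a, b) ∉ pre.edges := fun h' => hgr (r.edges_takeUntil_subset_edges _ h')
    set q := pre.toDeleteEdge s(u, w) hpre
    have hgq : s(a, b) ∉ q.edges := by simpa [q] using hgpre
    exact ⟨(q.toDeleteEdge s(a, b) hgq).copy rfl hd1⟩
  -- hence the side of `e` is inside the side of `g`; but `g` separates `o` from `u` in `T ∖ e`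
  have hss := h.2 _ hsep hge
  obtain ⟨s₀, hs₀⟩ := reachable_deleteEdges_iff_exists_walk.1 (hss.1 hu)
  set s := s₀.bypass
  have hsp : s.IsPath := s₀.bypass_isPath
  have hgs : s(a, b) ∉ s.edges := fun h' => hs₀ (s₀.edges_bypass_subset_edges h')
  by_cases hes : s(u, w) ∈ s.edges
  · -- `s` would enter `u` through `e` from `w`, putting `w` on the side of `e`
    obtain ⟨d', hd', hd'e⟩ := List.mem_map.1 hes
    have hfst : d'.fst ≠ u := fst_ne_end_of_mem_darts hsp hd'
    have h' := reachable_deleteEdges_fst_of_mem_darts hsp hd'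
    rw [hd'e] at h'
    rw [show d'.edge = s(d'.fst, d'.snd) from rfl, Sym2.eq_iff] at hd'e
    rcases hd'e with ⟨h1, -⟩ | ⟨h1, -⟩
    · exact hfst h1
    · exact hw (h1 ▸ h')
  · apply hng
    set q := s.toDeleteEdge s(u, w) hes
    have hgq : s(a, b) ∉ q.edges := by simpa [q] using hgs
    exact ⟨q.toDeleteEdge s(a, b) hgq⟩

/-- **The first edge through 2-edge-connectivity, backward**: a separating edge `s(u, w)` (near
endpoint `u`) such that `o` is `2`-edge-connected to `u` once it is deleted, is the first one.
[cite: Sakai2007, (2.9)] -/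
theorem isFirstSepEdge_of_isEdgeReachable_two {o x u w : V} (he : SepEdge T o x s(u, w))
    (hox : T.Reachable o x) (hu : u ∈ sepSide T o s(u, w))
    (h2 : (T.deleteEdges {s(u, w)}).IsEdgeReachable 2 o u) : IsFirstSepEdge T o x s(u, w) := by
  refine ⟨he, fun f hf hfe => ?_⟩
  obtain ⟨uf, wf, rfl, -, huf, -⟩ := hf.exists_near_far hox
  rcases side_ssubset_or he hf hox (Ne.symm hfe) hu huf with ⟨h, -⟩ | ⟨-, hout⟩
  · exact h
  · exfalso
    refine hout ?_
    have h := (_root_.SimpleGraph.isEdgeReachable_two.1 h2) s(uf, wf)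
    rw [deleteEdges_deleteEdges] at h
    exact h.mono (deleteEdges_anti Set.subset_union_right)

/-! ## The first pivotal dart -/

variable (T) in
/-- Sakai's qualifying directed bond for the decomposition (2.9): `o` is doubly connected to the
start `b̲` off `b`, and `x` is reached from the end `b̄` by a walk staying off the `o`-side of
`b` (`b̄ ⟷ x in 𝒞^b(o)ᶜ`); the bond itself being present (`n_b > 0`) is "`d` is a dart of `T`".
[cite: Sakai2007, (2.9)] -/
def IsFirstDart (o x : V) (d : T.Dart) : Prop :=
  (T.deleteEdges {d.edge}).IsEdgeReachable 2 o d.fst ∧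
    ∃ q : T.Walk d.snd x, ∀ z ∈ q.support, z ∉ sepSide T o d.edge

/-- A qualifying dart starts on the `o`-side of its edge. [folklore] -/
theorem IsFirstDart.fst_mem_side {o x : V} {d : T.Dart} (h : IsFirstDart T o x d) :
    d.fst ∈ sepSide T o d.edge :=
  h.1.reachable two_ne_zero

/-- The edge of a qualifying dart separates `o` from `x`. [cite: Sakai2007, (2.9)] -/
theorem IsFirstDart.sepEdge {o x : V} {d : T.Dart} (h : IsFirstDart T o x d) : SepEdge T o x d.edge := by
  obtain ⟨q, hq⟩ := h.2
  exact ⟨d.edge_mem, hq x q.end_mem_support⟩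

/-- A qualifying dart witnesses `o ⟷ x`. [folklore] -/
theorem IsFirstDart.reachable {o x : V} {d : T.Dart} (h : IsFirstDart T o x d) : T.Reachable o x := by
  obtain ⟨q, -⟩ := h.2
  exact ((h.fst_mem_side.mono (deleteEdges_le _)).trans d.adj.reachable).trans ⟨q⟩

/-- The edge of a qualifying dart is the first separating edge. [cite: Sakai2007, (2.9)] -/
theorem IsFirstDart.isFirstSepEdge {o x : V} {d : T.Dart} (h : IsFirstDart T o x d) : IsFirstSepEdge T o x d.edge :=
  isFirstSepEdge_of_isEdgeReachable_two h.sepEdge h.reachable h.fst_mem_side h.1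

/-- **Uniqueness**: there is at most one qualifying dart. [cite: Sakai2007, (2.9)] -/
theorem IsFirstDart.unique {o x : V} {d d' : T.Dart} (h : IsFirstDart T o x d)
    (h' : IsFirstDart T o x d') : d = d' := by
  have hedge : d.edge = d'.edge := h.isFirstSepEdge.unique h'.isFirstSepEdge
  rcases (dart_edge_eq_iff d d').1 hedge with hdd | hdd
  · exact hdd
  · exfalso
    have h1 : d.fst ∈ sepSide T o d'.edge := hedge ▸ h.fst_mem_side
    rw [hdd] at h1
    exact (h'.sepEdge.not_mem_side_of_mem h'.reachable h'.fst_mem_side) h1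

/-- No qualifying dart when `o` is `2`-edge-connected (doubly connected) to `x`. [cite: Sakai2007, (2.9)] -/
theorem IsFirstDart.not_isEdgeReachable_two {o x : V} {d : T.Dart} (h : IsFirstDart T o x d) :
    ¬T.IsEdgeReachable 2 o x := fun h2 =>
  h.sepEdge.2 ((_root_.SimpleGraph.isEdgeReachable_two.1 h2) d.edge)

/-- **Existence**: if `o ⟷ x` but not doubly (`2`-edge-) connected, on a finite vertex set there
is a qualifying dart — the first separating edge, oriented near-to-far. [cite: Sakai2007, (2.9)] -/
theorem exists_isFirstDart [Finite V] {o x : V} (hox : T.Reachable o x)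
    (h2 : ¬T.IsEdgeReachable 2 o x) : ∃ d : T.Dart, IsFirstDart T o x d := by
  classical
  rw [_root_.SimpleGraph.isEdgeReachable_two] at h2
  push Not at h2
  obtain ⟨g, hg⟩ := h2
  have hsep : SepEdge T o x g := by
    refine ⟨?_, hg⟩
    by_contra hmem
    rw [deleteEdges_eq_self.2 (Set.disjoint_singleton_right.2 hmem)] at hg
    exact hg hox
  obtain ⟨e, he⟩ := exists_isFirstSepEdge hsep hox
  obtain ⟨u, w, rfl, hadj, hu, hw⟩ := he.1.exists_near_far hox
  refine ⟨⟨(u, w), hadj⟩, he.isEdgeReachable_two hox hu, ?_⟩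
  -- the suffix after `e` of an `o`–`x` path stays off the side
  obtain ⟨p, hp⟩ := hox.exists_isPath
  obtain ⟨d, hd, hde⟩ := he.1.exists_dart p
  obtain ⟨hd1, hd2⟩ := he.1.dart_eq hp hd hde hu
  have hr := reachable_deleteEdges_snd_of_mem_darts hp hd
  rw [hde, hd2] at hr
  exact he.1.exists_walk_off_side hr

/-- The qualifying darts form a subsingleton. [cite: Sakai2007, (2.9)] -/
theorem subsingleton_isFirstDart (o x : V) : {d : T.Dart | IsFirstDart T o x d}.Subsingleton :=
  fun _ hd _ hd' => hd.unique hd'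

/-- **Trichotomy** (the indicator identity (2.9)): on a finite vertex set a qualifying dart exists
iff `o ⟷ x` without double (`2`-edge-) connection; together with `subsingleton_isFirstDart`, the
sum over darts in (2.9) has exactly one nonzero term in that case and none otherwise.
[cite: Sakai2007, (2.9)] -/
theorem exists_isFirstDart_iff [Finite V] (o x : V) :
    (∃ d : T.Dart, IsFirstDart T o x d) ↔ T.Reachable o x ∧ ¬T.IsEdgeReachable 2 o x :=
  ⟨fun ⟨_, hd⟩ => ⟨hd.reachable, hd.not_isEdgeReachable_two⟩, fun h => exists_isFirstDart h.1 h.2⟩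

end Literature.Combinatorics.SimpleGraph
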